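import Mathlib.Analysis.Calculus.BumpFunction.FiniteDimension
import Literature.Barriers.AtomisticToContinuum.NoBVEstimatesMultiDFinitePropagation
import HarnessLib

/-!
# Symmetrizable systems near a constant state: cut-off and normalisation to `A₀ = I`

First brick of the existence half (Kato's local existence theorem for the symmetrizable branch)
of the programme to discharge `Rauch1986_smallAmplitudeExpansionL2`. The energy method for the
quasilinear system (1), `A₀(u)∂ₜu + Σⱼ Aⱼ(u)∂ⱼu + B(u) = 0`, symmetrizable on a neighbourhood of
`ū` (`IsSymmetrizableNear`: a smooth `Sym(u)` with `Sym A₀` symmetric positive definite and the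
`Sym Aⱼ` symmetric near `ū`), is run on a MODIFIED system whose coefficients are globally defined,
smooth, bounded and agree with those of (1) near `ū` [Majda1984, Ch. 2, §2.1 ("we modify the
coefficients outside a neighbourhood ...")], [Taylor, PDE III, Ch. 16 §1]; its small solutions
stay near `ū` and therefore solve (1). This file performs that preliminary reduction:

* `cutoff ū r` — a smooth map `χ : ℝᵏ → ℝᵏ` with `χ = id` on the closed ball `B̄(ū, r)`,
  `χ(w) ∈ B̄(ū, 2r)` for all `w`, and `χ ≡ ū` off `B̄(ū, 2r)` (`χ(w) = ū + ψ(w)(w - ū)`, `ψ` a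
  smooth bump);
* `normalize S ū r` — the system `∂ₜu + Σⱼ (A₀⁻¹Aⱼ)(χ u)∂ⱼu + (A₀⁻¹B)(χ u) = 0` (`A₀ = I`), a
  `QuasilinearSystem` (smoothness of `A₀(χ u)⁻¹` entrywise through `det` and the adjugate);
* `IsClassicalSolution.of_normalize` — a classical solution of the normalised system with values
  in `B̄(ū, r)` is a classical solution of `S` (multiply by `A₀(u)`);
* `normSym S Sym ū r` — the symmetrizer `S̃(w) = (Sym A₀)(χ w)` of the normalised system:
  symmetric positive definite, `S̃ · (A₀⁻¹Aⱼ)(χ w) = (Sym Aⱼ)(χ w)` symmetric, for EVERY state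
  `w` once `B̄(ū, 2r)` lies in the neighbourhood where `Sym` works (`exists_radius`).

Everything is proved; no named fact and no `sorry` is introduced.

## References

* [Majda1984] A. Majda, *Compressible Fluid Flow and Systems of Conservation Laws in Several
  Space Variables* (1984), Ch. 2, §2.1, Thm 2.1.
* [Rauch1986] J. Rauch, Comm. Math. Phys. 106 (1986) 481–484, Local Existence Theorem p. 482.
-/

noncomputable section

open Set Filter Matrix Metric
open scoped ContDiff Topology

namespace Literature.Barriers.AtomisticToContinuum

open Literature.Analysis.FluidPDE QuasilinearSystem

variable {d k : ℕ}

/-! ### The cut-off map -/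

section Cutoff

variable (ubar : Fin k → ℝ) {r : ℝ}

/-- A smooth bump on `ℝᵏ` equal to `1` on `B̄(ū, r)` and supported in `B(ū, 2r)`. [folklore] -/
def bump (hr : 0 < r) : ContDiffBump ubar :=
  ⟨r, 2 * r, hr, by linarith⟩

/-- **The cut-off map** `χ(w) = ū + ψ(w)(w - ū)`. [cite: Majda1984, Ch. 2 §2.1] -/
def cutoff (hr : 0 < r) (w : Fin k → ℝ) : Fin k → ℝ :=
  ubar + (bump ubar hr : (Fin k → ℝ) → ℝ) w • (w - ubar)

/-- `χ` is smooth. [folklore] -/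
theorem contDiff_cutoff (hr : 0 < r) : ContDiff ℝ ∞ (cutoff ubar hr) :=
  contDiff_const.add ((bump ubar hr).contDiff.smul (contDiff_id.sub contDiff_const))

/-- `χ = id` on `B̄(ū, r)`. [folklore] -/
theorem cutoff_eq_self (hr : 0 < r) {w : Fin k → ℝ} (hw : w ∈ closedBall ubar r) :
    cutoff ubar hr w = w := by
  rw [cutoff, (bump ubar hr).one_of_mem_closedBall hw, one_smul, add_sub_cancel]

/-- `χ ≡ ū` off `B(ū, 2r)`. [folklore] -/
theorem cutoff_eq_ubar (hr : 0 < r) {w : Fin k → ℝ} (hw : 2 * r ≤ dist w ubar) :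
    cutoff ubar hr w = ubar := by
  rw [cutoff, (bump ubar hr).zero_of_le_dist hw, zero_smul, add_zero]

/-- `χ(w) ∈ B̄(ū, 2r)` for every `w`. [folklore] -/
theorem cutoff_mem_closedBall (hr : 0 < r) (w : Fin k → ℝ) :
    cutoff ubar hr w ∈ closedBall ubar (2 * r) := by
  rw [mem_closedBall, cutoff, dist_eq_norm, add_sub_cancel_left, norm_smul, Real.norm_eq_abs,
    abs_of_nonneg (bump ubar hr).nonneg]
  by_cases hw : dist w ubar < 2 * r
  · calc (bump ubar hr) w * ‖w - ubar‖ ≤ 1 * ‖w - ubar‖ :=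
          mul_le_mul_of_nonneg_right (bump ubar hr).le_one (norm_nonneg _)
      _ ≤ 2 * r := by rw [one_mul, ← dist_eq_norm]; exact hw.le
  · rw [(bump ubar hr).zero_of_le_dist (not_lt.1 hw), zero_mul]
    positivity

/-- The components of `χ` are smooth. [folklore] -/
theorem contDiff_cutoff_apply (hr : 0 < r) (i : Fin k) : ContDiff ℝ ∞ fun w => cutoff ubar hr w i :=
  (contDiff_apply ℝ ℝ i).comp (contDiff_cutoff ubar hr)

end Cutoff

/-! ### Smoothness of determinants and inverses from entrywise smoothness -/

section MatrixCalculus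

variable {X : Type*} [NormedAddCommGroup X] [NormedSpace ℝ X] {n : WithTop ℕ∞}
  {M : X → Matrix (Fin k) (Fin k) ℝ}

/-- The determinant of an entrywise smooth matrix field is smooth (Leibniz expansion).
[folklore] -/
theorem contDiff_det_of_entry (hM : ∀ i j, ContDiff ℝ n fun x => M x i j) :
    ContDiff ℝ n fun x => (M x).det := by
  simp_rw [Matrix.det_apply']
  refine ContDiff.sum fun σ _ => ?_
  exact contDiff_const.mul (contDiff_prod fun i _ => hM (σ i) i)

/-- The adjugate of an entrywise smooth matrix field is entrywise smooth. [folklore] -/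
theorem contDiff_adjugate_of_entry (hM : ∀ i j, ContDiff ℝ n fun x => M x i j) (i j : Fin k) :
    ContDiff ℝ n fun x => (M x).adjugate i j := by
  simp_rw [Matrix.adjugate_apply]
  refine contDiff_det_of_entry fun a b => ?_
  by_cases ha : a = j
  · subst ha
    simp_rw [Matrix.updateRow_self]
    exact contDiff_const
  · simp_rw [Matrix.updateRow_ne ha]
    exact hM a b

/-- **The inverse of an entrywise smooth matrix field with nonvanishing determinant is entrywise
smooth** (`A⁻¹ = (det A)⁻¹ adj A`). [folklore] -/
theorem contDiff_inv_of_entry (hM : ∀ i j, ContDiff ℝ n fun x => M x i j)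
    (hdet : ∀ x, (M x).det ≠ 0) (i j : Fin k) : ContDiff ℝ n fun x => (M x)⁻¹ i j := by
  have hfun : (fun x => (M x)⁻¹ i j) = fun x => ((M x).det)⁻¹ * (M x).adjugate i j := by
    funext x
    rw [Matrix.inv_def, Matrix.smul_apply, Ring.inverse_eq_inv', smul_eq_mul]
  rw [hfun]
  exact ((contDiff_det_of_entry hM).inv hdet).mul (contDiff_adjugate_of_entry hM i j)

/-- Entrywise smoothness of a product of entrywise smooth matrix fields. [folklore] -/
theorem contDiff_mul_of_entry {N : X → Matrix (Fin k) (Fin k) ℝ}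
    (hM : ∀ i j, ContDiff ℝ n fun x => M x i j) (hN : ∀ i j, ContDiff ℝ n fun x => N x i j)
    (i j : Fin k) : ContDiff ℝ n fun x => (M x * N x) i j := by
  simp only [Matrix.mul_apply]
  exact ContDiff.sum fun l _ => (hM i l).mul (hN l j)

/-- Smoothness of `x ↦ M(x) w(x)` from entrywise smoothness. [folklore] -/
theorem contDiff_mulVec_of_entry' {w : X → Fin k → ℝ} (hM : ∀ i j, ContDiff ℝ n fun x => M x i j)
    (hw : ContDiff ℝ n w) : ContDiff ℝ n fun x => M x *ᵥ w x := by
  refine contDiff_pi.2 fun i => ?_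
  simp only [Matrix.mulVec, dotProduct]
  exact ContDiff.sum fun l _ => (hM i l).mul ((contDiff_apply ℝ ℝ l).comp hw)

end MatrixCalculus

/-! ### The radius of symmetrizability -/

/-- **A quantitative neighbourhood**: a symmetrizable system at `ū` has a smooth symmetrizer
working on the closed ball `B̄(ū, 3r)` for some `r > 0`. [cite: Rauch1986, p. 482] -/
theorem exists_radius {S : QuasilinearSystem d k} {ubar : Fin k → ℝ} (h : S.IsSymmetrizableNear ubar) :
    ∃ (Sym : (Fin k → ℝ) → Matrix (Fin k) (Fin k) ℝ) (r : ℝ), 0 < r ∧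
      (∀ i i', ContDiff ℝ ∞ fun u => Sym u i i') ∧
      ∀ w ∈ closedBall ubar (3 * r), (Sym w * S.A0 w).PosDef ∧ ∀ j, (Sym w * S.A j w).IsSymm := by
  obtain ⟨U, hU, Sym, hSym, hU'⟩ := h
  obtain ⟨ρ, hρ, hball⟩ := Metric.mem_nhds_iff.1 hU
  refine ⟨Sym, ρ / 4, by positivity, hSym, fun w hw => hU' w (hball ?_)⟩
  rw [mem_closedBall] at hw
  rw [mem_ball]
  linarith

/-! ### The normalised system -/

section Normalize

variable (S : QuasilinearSystem d k) (ubar : Fin k → ℝ) {r : ℝ} (hr : 0 < r)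
  (hdet : ∀ w ∈ closedBall ubar (2 * r), (S.A0 w).det ≠ 0)

include hdet in
/-- `det A₀(χ w) ≠ 0` for every `w`. [folklore] -/
theorem det_A0_cutoff_ne_zero (w : Fin k → ℝ) : (S.A0 (cutoff ubar hr w)).det ≠ 0 :=
  hdet _ (cutoff_mem_closedBall ubar hr w)

/-- **The normalised system** `∂ₜu + Σⱼ (A₀⁻¹Aⱼ)(χ u)∂ⱼu + (A₀⁻¹B)(χ u) = 0`: `A₀ = I`, and the
coefficients are those of `A₀⁻¹ ·` (1) composed with the cut-off, hence globally defined and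
smooth, equal to `A₀(u)⁻¹Aⱼ(u)`, `A₀(u)⁻¹B(u)` for `u ∈ B̄(ū, r)`.
[cite: Majda1984, Ch. 2 §2.1] -/
def normalize : QuasilinearSystem d k where
  A0 := fun _ => 1
  A := fun j w => (S.A0 (cutoff ubar hr w))⁻¹ * S.A j (cutoff ubar hr w)
  B := fun w => (S.A0 (cutoff ubar hr w))⁻¹ *ᵥ S.B (cutoff ubar hr w)
  contDiff_A0 := fun _ _ => contDiff_const
  contDiff_A := fun j i i' =>
    contDiff_mul_of_entry
      (contDiff_inv_of_entry (fun a b => (S.contDiff_A0 a b).comp (contDiff_cutoff ubar hr))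
        (det_A0_cutoff_ne_zero S ubar hr hdet))
      (fun a b => (S.contDiff_A j a b).comp (contDiff_cutoff ubar hr)) i i'
  contDiff_B :=
    contDiff_mulVec_of_entry'
      (contDiff_inv_of_entry (fun a b => (S.contDiff_A0 a b).comp (contDiff_cutoff ubar hr))
        (det_A0_cutoff_ne_zero S ubar hr hdet))
      (S.contDiff_B.comp (contDiff_cutoff ubar hr))

/-- Unfolding: `A₀ = 1`. [folklore] -/
@[simp] theorem normalize_A0 (w : Fin k → ℝ) : (normalize S ubar hr hdet).A0 w = 1 := rfl

/-- Unfolding: `Aⱼ(w) = A₀(χ w)⁻¹ Aⱼ(χ w)`. [folklore] -/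
theorem normalize_A (j : Fin d) (w : Fin k → ℝ) :
    (normalize S ubar hr hdet).A j w = (S.A0 (cutoff ubar hr w))⁻¹ * S.A j (cutoff ubar hr w) := rfl

/-- Unfolding: `B(w) = A₀(χ w)⁻¹ B(χ w)`. [folklore] -/
theorem normalize_B (w : Fin k → ℝ) :
    (normalize S ubar hr hdet).B w = (S.A0 (cutoff ubar hr w))⁻¹ *ᵥ S.B (cutoff ubar hr w) := rfl

/-- On `B̄(ū, r)` the coefficients are `A₀(w)⁻¹Aⱼ(w)`. [folklore] -/
theorem normalize_A_of_mem (j : Fin d) {w : Fin k → ℝ} (hw : w ∈ closedBall ubar r) :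
    (normalize S ubar hr hdet).A j w = (S.A0 w)⁻¹ * S.A j w := by
  rw [normalize_A, cutoff_eq_self ubar hr hw]

/-- On `B̄(ū, r)` the zeroth-order term is `A₀(w)⁻¹B(w)`. [folklore] -/
theorem normalize_B_of_mem {w : Fin k → ℝ} (hw : w ∈ closedBall ubar r) :
    (normalize S ubar hr hdet).B w = (S.A0 w)⁻¹ *ᵥ S.B w := by
  rw [normalize_B, cutoff_eq_self ubar hr hw]

/-- Off `B(ū, 2r)` the coefficients are constant, `A₀(ū)⁻¹Aⱼ(ū)`. [folklore] -/
theorem normalize_A_of_le_dist (j : Fin d) {w : Fin k → ℝ} (hw : 2 * r ≤ dist w ubar) :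
    (normalize S ubar hr hdet).A j w = (S.A0 ubar)⁻¹ * S.A j ubar := by
  rw [normalize_A, cutoff_eq_ubar ubar hr hw]

/-- Off `B(ū, 2r)` the zeroth-order term is constant, `A₀(ū)⁻¹B(ū)` (`= 0` if `B(ū) = 0`).
[folklore] -/
theorem normalize_B_of_le_dist {w : Fin k → ℝ} (hw : 2 * r ≤ dist w ubar) :
    (normalize S ubar hr hdet).B w = (S.A0 ubar)⁻¹ *ᵥ S.B ubar := by
  rw [normalize_B, cutoff_eq_ubar ubar hr hw]

/-- `B(ū) = 0` is inherited. [folklore] -/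
theorem normalize_B_ubar (hB : S.B ubar = 0) : (normalize S ubar hr hdet).B ubar = 0 := by
  rw [normalize_B_of_mem S ubar hr hdet (mem_closedBall_self hr.le), hB, mulVec_zero]

/-- **Back to the original system**: a classical solution of the normalised system taking its
values in `B̄(ū, r)` is a classical solution of (1) (multiply the equation by `A₀(u)`).
[cite: Majda1984, Ch. 2 §2.1] -/
theorem IsClassicalSolution.of_normalize {T : ℝ} {u : ℝ → Space d → Fin k → ℝ}
    (hu : (normalize S ubar hr hdet).IsClassicalSolution T u)
    (hball : ∀ t ∈ Icc 0 T, ∀ x : Space d, u t x ∈ closedBall ubar r) :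
    S.IsClassicalSolution T u where
  contDiffOn := hu.contDiffOn
  eqn := by
    intro t ht x
    have hmem := hball t ht x
    have h := hu.eqn t ht x
    rw [normalize_A0, normalize_B_of_mem S ubar hr hdet hmem] at h
    simp_rw [normalize_A_of_mem S ubar hr hdet _ hmem] at h
    have hunit : IsUnit (S.A0 (u t x)).det :=
      isUnit_iff_ne_zero.2 (hdet _ (closedBall_subset_closedBall (by linarith) hmem))
    have h2 := congr_arg (fun y => S.A0 (u t x) *ᵥ y) h
    simp only [mulVec_add, one_mulVec, mulVec_zero, Matrix.mulVec_sum, mulVec_mulVec,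
      ← Matrix.mul_assoc, mul_nonsing_inv _ hunit, Matrix.one_mul] at h2
    exact h2

end Normalize

/-! ### The symmetrizer of the normalised system -/

section NormSym

variable (S : QuasilinearSystem d k) (Sym : (Fin k → ℝ) → Matrix (Fin k) (Fin k) ℝ)
  (ubar : Fin k → ℝ) {r : ℝ} (hr : 0 < r)

/-- **The symmetrizer of the normalised system**, `S̃(w) = Sym(χ w) A₀(χ w)`.
[cite: Majda1984, Ch. 2 §2.1] -/
def normSym (w : Fin k → ℝ) : Matrix (Fin k) (Fin k) ℝ :=
  Sym (cutoff ubar hr w) * S.A0 (cutoff ubar hr w)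

variable {S Sym}

/-- The symmetrizability gives `det A₀ ≠ 0` on `B̄(ū, 2r)`. [folklore] -/
theorem det_ne_zero_of_sym
    (hSym : ∀ w ∈ closedBall ubar (2 * r), (Sym w * S.A0 w).PosDef ∧ ∀ j, (Sym w * S.A j w).IsSymm) :
    ∀ w ∈ closedBall ubar (2 * r), (S.A0 w).det ≠ 0 := by
  intro w hw h0
  have h := (hSym w hw).1.det_pos
  rw [det_mul, h0, mul_zero] at h
  exact lt_irrefl _ h

/-- **`S̃(w)` is symmetric positive definite for every state `w`.** [folklore] -/
theorem posDef_normSym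
    (hSym : ∀ w ∈ closedBall ubar (2 * r), (Sym w * S.A0 w).PosDef ∧ ∀ j, (Sym w * S.A j w).IsSymm)
    (w : Fin k → ℝ) : (normSym S Sym ubar hr w).PosDef :=
  (hSym _ (cutoff_mem_closedBall ubar hr w)).1

/-- **`S̃ Ãⱼ` is symmetric**: `S̃(w) · (A₀⁻¹Aⱼ)(χ w) = (Sym Aⱼ)(χ w)`. [folklore] -/
theorem normSym_mul_normalize_A
    (hSym : ∀ w ∈ closedBall ubar (2 * r), (Sym w * S.A0 w).PosDef ∧ ∀ j, (Sym w * S.A j w).IsSymm)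
    (j : Fin d) (w : Fin k → ℝ) :
    normSym S Sym ubar hr w * (normalize S ubar hr (det_ne_zero_of_sym ubar hSym)).A j w =
      Sym (cutoff ubar hr w) * S.A j (cutoff ubar hr w) := by
  have hunit : IsUnit (S.A0 (cutoff ubar hr w)).det :=
    isUnit_iff_ne_zero.2 (det_ne_zero_of_sym ubar hSym _ (cutoff_mem_closedBall ubar hr w))
  rw [normSym, normalize_A, Matrix.mul_assoc, ← Matrix.mul_assoc (S.A0 _), mul_nonsing_inv _ hunit,
    Matrix.one_mul]

/-- Hence `S̃ Ãⱼ` is symmetric for every state. [folklore] -/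
theorem isSymm_normSym_mul_normalize_A
    (hSym : ∀ w ∈ closedBall ubar (2 * r), (Sym w * S.A0 w).PosDef ∧ ∀ j, (Sym w * S.A j w).IsSymm)
    (j : Fin d) (w : Fin k → ℝ) :
    (normSym S Sym ubar hr w * (normalize S ubar hr (det_ne_zero_of_sym ubar hSym)).A j w).IsSymm := by
  rw [normSym_mul_normalize_A ubar hr hSym]
  exact (hSym _ (cutoff_mem_closedBall ubar hr w)).2 j

/-- `S̃` is entrywise smooth. [folklore] -/
theorem contDiff_normSym_apply (hSymd : ∀ i i', ContDiff ℝ ∞ fun u => Sym u i i') (i i' : Fin k) :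
    ContDiff ℝ ∞ fun w => normSym S Sym ubar hr w i i' :=
  contDiff_mul_of_entry (fun a b => (hSymd a b).comp (contDiff_cutoff ubar hr))
    (fun a b => (S.contDiff_A0 a b).comp (contDiff_cutoff ubar hr)) i i'

/-- Off `B(ū, 2r)` the symmetrizer is constant. [folklore] -/
theorem normSym_of_le_dist {w : Fin k → ℝ} (hw : 2 * r ≤ dist w ubar) :
    normSym S Sym ubar hr w = Sym ubar * S.A0 ubar := by
  rw [normSym, cutoff_eq_ubar ubar hr hw]

/-- **Uniform coercivity and boundedness of the symmetrizer**: there are `c > 0` and `C` with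
`c‖y‖² ≤ yᵀS̃(w)y` and `|S̃(w)ᵢⱼ| ≤ C` for all states `w` and all `y` (compactness of
`B̄(ū, 2r) × {‖y‖ = 1}`, the values of `χ` lying in the ball). [folklore] -/
theorem exists_normSym_bounds (hSymd : ∀ i i', ContDiff ℝ ∞ fun u => Sym u i i')
    (hSym : ∀ w ∈ closedBall ubar (2 * r), (Sym w * S.A0 w).PosDef ∧ ∀ j, (Sym w * S.A j w).IsSymm) :
    ∃ c C : ℝ, 0 < c ∧ 0 ≤ C ∧ ∀ w : Fin k → ℝ,
      (∀ y : Fin k → ℝ, c * ‖y‖ ^ 2 ≤ y ⬝ᵥ (normSym S Sym ubar hr w *ᵥ y)) ∧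
      ∀ i i', |normSym S Sym ubar hr w i i'| ≤ C := by
  set K : Set (Fin k → ℝ) := closedBall ubar (2 * r) with hK
  have hKc : IsCompact K := isCompact_closedBall _ _
  set Q : (Fin k → ℝ) → Matrix (Fin k) (Fin k) ℝ := fun p => Sym p * S.A0 p with hQ
  have hQc : Continuous Q := by
    refine continuous_pi fun i => continuous_pi fun i' => ?_
    simp only [hQ, Matrix.mul_apply]
    exact continuous_finsetSum _ fun l _ =>
      ((hSymd i l).continuous).mul ((S.contDiff_A0 l i').continuous)
  -- the entry bound
  have hcont_abs : Continuous fun p => ∑ i, ∑ i', |Q p i i'| :=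
    continuous_finsetSum _ fun i _ => continuous_finsetSum _ fun i' _ =>
      continuous_abs.comp ((continuous_apply i').comp ((continuous_apply i).comp hQc))
  obtain ⟨N, hN⟩ := hKc.bddAbove_image hcont_abs.continuousOn
  have hN' : ∀ p ∈ K, ∑ i, ∑ i', |Q p i i'| ≤ N := fun p hp => hN ⟨p, hp, rfl⟩
  have hN0 : 0 ≤ N := (Finset.sum_nonneg fun i _ => Finset.sum_nonneg fun i' _ => abs_nonneg _).trans
    (hN' ubar (mem_closedBall_self (by positivity)))
  have hentry : ∀ p ∈ K, ∀ i i', |Q p i i'| ≤ N := by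
    intro p hp i i'
    refine le_trans ?_ (hN' p hp)
    refine le_trans ?_ (Finset.single_le_sum (f := fun a => ∑ b, |Q p a b|)
      (fun _ _ => Finset.sum_nonneg fun _ _ => abs_nonneg _) (Finset.mem_univ i))
    exact Finset.single_le_sum (f := fun b => |Q p i b|) (fun _ _ => abs_nonneg _) (Finset.mem_univ i')
  -- the coercivity constant
  set F : (Fin k → ℝ) × (Fin k → ℝ) → ℝ := fun q => q.2 ⬝ᵥ (Q q.1 *ᵥ q.2) with hF
  have hFc : Continuous F :=
    continuous_snd.dotProduct ((hQc.comp continuous_fst).matrix_mulVec continuous_snd)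
  have hcpt : IsCompact (K ×ˢ sphere (0 : Fin k → ℝ) 1) := hKc.prod (isCompact_sphere _ _)
  have hposF : ∀ q ∈ K ×ˢ sphere (0 : Fin k → ℝ) 1, 0 < F q := by
    rintro ⟨p, y⟩ ⟨hp, hy⟩
    have hy0 : y ≠ 0 := by
      intro h0; rw [h0, mem_sphere_zero_iff_norm, norm_zero] at hy; exact zero_ne_one hy
    simpa [hF] using (hSym p hp).1.dotProduct_mulVec_pos hy0
  have hscale : ∀ (p y : Fin k → ℝ), F (p, ‖y‖⁻¹ • y) = (‖y‖ ^ 2)⁻¹ * (y ⬝ᵥ (Q p *ᵥ y)) := by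
    intro p y
    simp only [hF, mulVec_smul, dotProduct_smul, smul_dotProduct, smul_eq_mul]
    ring
  -- the conclusion for states in `K`, then for all states through `χ`
  suffices hmain : ∃ c : ℝ, 0 < c ∧ ∀ p ∈ K, ∀ y : Fin k → ℝ, c * ‖y‖ ^ 2 ≤ y ⬝ᵥ (Q p *ᵥ y) by
    obtain ⟨c, hc, hcK⟩ := hmain
    exact ⟨c, N, hc, hN0, fun w => ⟨fun y => hcK _ (cutoff_mem_closedBall ubar hr w) y,
      fun i i' => hentry _ (cutoff_mem_closedBall ubar hr w) i i'⟩⟩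
  rcases (K ×ˢ sphere (0 : Fin k → ℝ) 1).eq_empty_or_nonempty with hempty | hne
  · refine ⟨1, one_pos, fun p hp y => ?_⟩
    rcases eq_or_ne y 0 with rfl | hy
    · simp
    · exfalso
      have hmem : (p, ‖y‖⁻¹ • y) ∈ K ×ˢ sphere (0 : Fin k → ℝ) 1 := by
        refine mk_mem_prod hp ?_
        rw [mem_sphere_zero_iff_norm, norm_smul, norm_inv, norm_norm,
          inv_mul_cancel₀ (norm_ne_zero_iff.2 hy)]
      rw [hempty] at hmem
      exact hmem
  · obtain ⟨q₀, hq₀, hmin⟩ := hcpt.exists_isMinOn hne hFc.continuousOn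
    refine ⟨F q₀, hposF q₀ hq₀, fun p hp y => ?_⟩
    rcases eq_or_ne y 0 with rfl | hy
    · simp
    · have hny : 0 < ‖y‖ := norm_pos_iff.2 hy
      have hmem : (p, ‖y‖⁻¹ • y) ∈ K ×ˢ sphere (0 : Fin k → ℝ) 1 := by
        refine mk_mem_prod hp ?_
        rw [mem_sphere_zero_iff_norm, norm_smul, norm_inv, norm_norm, inv_mul_cancel₀ hny.ne']
      have h := hmin hmem
      rw [mem_setOf_eq, hscale] at h
      calc F q₀ * ‖y‖ ^ 2 ≤ ((‖y‖ ^ 2)⁻¹ * (y ⬝ᵥ (Q p *ᵥ y))) * ‖y‖ ^ 2 :=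
            mul_le_mul_of_nonneg_right h (sq_nonneg _)
        _ = y ⬝ᵥ (Q p *ᵥ y) := by
            field_simp

end NormSym

end Literature.Barriers.AtomisticToContinuum

end
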